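import Summits.FinalStateConjecture.FinalStateConjecture.Theorems.ZeroEnergyKerrOrBombStationaryLimitReductionKerrIsometryRigidityWave3Facts
import Summits.FinalStateConjecture.FinalStateConjecture.Theorems.ZeroEnergyKerrOrBombStationaryLimitReductionTimeEquivariantMaps
import Summits.FinalStateConjecture.FinalStateConjecture.Theorems.ZeroEnergyKerrOrBombStationaryLimitReductionChartReadaptation
import Literature.Geometry.Lorentzian.ADMTransitionRigidity
import Literature.Geometry.Lorentzian.MultiCentreKerrSchild
import Literature.Geometry.Lorentzian.KerrWaveEnergy
import HarnessLib

/-!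
# Route ZeroEnergyKerrOrBomb · crux `FinalStateFromKerrOrBomb` (stmt-FinalStateConjecture-17839), line `SketchIdeator1` —
# stub `stub_kerrAsymptoticRigidity` (F4 of stub 1R), layer 10: `D³Θ` is bounded far out
Helper file (`--supports stmt-FinalStateConjecture-17839`; helper `kerrAsymptoticRigidity_iteratedFDeriv_three_bounded`) for
`stub_kerrAsymptoticRigidity := KerrAsymptoticRigidity` (`…KerrIsometryRigidityWave3Facts`). Hypotheses: the binder list of
`KerrAsymptoticRigidity` VERBATIM, then `c = 1` (layer 1), layer 2 (p137926: `‖dΘ_u‖ ≤ L`, `‖v‖ ≤ L ‖dΘ_u v‖` on `{r ≥ R}`) and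
layer 4 (p138505: `‖D²Θ‖ ≤ L₂` on `{r ≥ R'}`). Conclusion: `‖D³Θ‖ ≤ L₃` on some `{r ≥ R₃}`. §1 the Lorentzian Christoffel trick
with a parameter (private `_w3` copies of the §1 kit of `…KerrAsymptoticRigidityD2`, unbuilt today); §2 the SECOND differentiated
transformation law (one more derivative of `TransitionRigidity.fderiv_law_apply`: ten terms, two with `D³Θ`, forming the
symmetrisation in `(v, w)` of `T_t(u,v,w) = h(Θy)(D³Θ(t,u,v), dΘ w)`; `D³Θ(t,·,·)` is symmetric); §3–§4 the other eight terms and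
`D²g_{M,a}` are products of `dΘ, D²Θ` (bounded by hypothesis) with `h, Dh, D²h ∘ Θ` and `D²g_{M,a}` (bounded far out: `1/4`-closeness,
the `C²` clause of `ChartIsAsymptoticallySchwarzschildean'`, `Kerr.norm_iteratedFDeriv_ksPert_le`), whence `‖D³Θ(t,·,·)‖ ≤ 18LN⁵‖t‖`.
Elementary; nothing restated. References: R. Bartnik, CPAM 39 (1986), §3, (3.5)–(3.6), Cor. 3.2; P. T. Chruściel, *Boundary
conditions at spatial infinity* (1986), §2; Chruściel–Costa, arXiv:0806.0016, §2.1.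
-/

set_option linter.dupNamespace false
-- instance search through the nested operator types `E4 →L[ℝ] E4 →L[ℝ] E4 →L[ℝ] E4 →L[ℝ] ℝ`
set_option maxSynthPendingDepth 4

noncomputable section

open scoped Manifold ContDiff Topology
open Set Filter Function

namespace Summit.FinalStateConjecture.FinalStateConjecture.Theorems.SymplecticDualOfTheBomb

open Literature.Geometry.Lorentzian Summit.FinalStateConjecture.FinalStateConjecture.Theorems.OneLockedExplosion

/-! ## §1 The Lorentzian Christoffel trick, bounded-symmetrisation form -/

/-- `η(w, w) = ‖w‖² − 2 (w⁰)²` (Euclidean norm of `E4`). [folklore] -/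
private theorem minkowski_self_eq_w3 (w : E4) : Minkowski.bilin w w = ‖w‖ ^ 2 - 2 * w 0 ^ 2 := by
  -- private copy of `minkowski_self_eq` (`…KerrAsymptoticRigidityD2`, unbuilt today)
  have h : ‖w‖ ^ 2 = w 0 ^ 2 + ∑ i : Fin 3, w i.succ ^ 2 := by
    rw [EuclideanSpace.real_norm_sq_eq, Fin.sum_univ_succ]
  rw [Minkowski.bilin_apply, h, Finset.sum_congr rfl fun (i : Fin 3) _ ↦ (sq (w i.succ)).symm]
  ring

/-- `|B(v, w) − η(v, w)| ≤ ‖v‖ ‖w‖ / 4` for `‖B − η‖ ≤ 1/4`. [folklore] -/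
private theorem abs_sub_minkowski_le_w3 {B : E4 →L[ℝ] E4 →L[ℝ] ℝ} (hB : ‖B - Minkowski.bilin‖ ≤ 1 / 4) (v w : E4) :
    |B v w - Minkowski.bilin v w| ≤ ‖v‖ * ‖w‖ / 4 := by
  -- private copy of `abs_sub_minkowski_le` (`…KerrAsymptoticRigidityD2`, unbuilt today)
  have h := (B - Minkowski.bilin).le_opNorm₂ v w
  rw [Real.norm_eq_abs, sub_apply, sub_apply] at h
  calc |B v w - Minkowski.bilin v w| ≤ ‖B - Minkowski.bilin‖ * ‖v‖ * ‖w‖ := h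
    _ ≤ 1 / 4 * ‖v‖ * ‖w‖ := by gcongr
    _ = ‖v‖ * ‖w‖ / 4 := by ring

/-- The time reflection `𝒫 p = p − 2 p⁰ e₀` is a Euclidean isometry with `η(p, 𝒫 p) = ‖p‖²`. [folklore] -/
private theorem timeReflect_w3 (p : E4) : ‖p - (2 * p 0) • E4.basisVector 0‖ = ‖p‖ ∧
    Minkowski.bilin p (p - (2 * p 0) • E4.basisVector 0) = ‖p‖ ^ 2 := by
  -- condensed private copy of `norm_timeReflect`, `minkowski_timeReflect` (`…KerrAsymptoticRigidityD2`)
  have h0 : (p - (2 * p 0) • E4.basisVector 0) 0 = -p 0 := by simp; ring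
  have h2 : Minkowski.bilin p (p - (2 * p 0) • E4.basisVector 0) = ‖p‖ ^ 2 := by
    rw [map_sub, map_smul, Minkowski.bilin_symm p (E4.basisVector 0), Minkowski.bilin_basisVector_zero_left, minkowski_self_eq_w3,
      smul_eq_mul]
    ring
  have h1 := minkowski_self_eq_w3 (p - (2 * p 0) • E4.basisVector 0)
  rw [map_sub Minkowski.bilin, map_smul, sub_apply, smul_apply, Minkowski.bilin_basisVector_zero_left, h0, h2, smul_eq_mul] at h1
  exact ⟨(pow_left_inj₀ (norm_nonneg _) (norm_nonneg _) two_ne_zero).1 (by linarith), h2⟩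

/-- **Coercivity by time reflection**: `(3/4)‖p‖² ≤ B(p, 𝒫 p)` for `‖B − η‖ ≤ 1/4`. [folklore] -/
private theorem sq_le_apply_timeReflect_w3 {B : E4 →L[ℝ] E4 →L[ℝ] ℝ} (hB : ‖B - Minkowski.bilin‖ ≤ 1 / 4) (p : E4) :
    3 / 4 * ‖p‖ ^ 2 ≤ B p (p - (2 * p 0) • E4.basisVector 0) := by
  -- private copy of `sq_le_apply_timeReflect` (`…KerrAsymptoticRigidityD2`, unbuilt today)
  have h := abs_sub_minkowski_le_w3 hB p (p - (2 * p 0) • E4.basisVector 0)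
  rw [(timeReflect_w3 p).2, (timeReflect_w3 p).1] at h
  nlinarith [(abs_le.1 h).1]

/-- A linear map of `E4` with `‖v‖ ≤ L ‖P v‖` is surjective (injective, finite dimension). [folklore] -/
private theorem surjective_of_norm_le_w3 {P : E4 →L[ℝ] E4} {L : ℝ} (hPl : ∀ v, ‖v‖ ≤ L * ‖P v‖) : Function.Surjective P := by
  -- private copy of `surjective_of_norm_le` (`…KerrAsymptoticRigidityD2`, unbuilt today)
  refine LinearMap.surjective_of_injective (f := (P : E4 →ₗ[ℝ] E4)) fun v w hvw ↦ ?_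
  have h := hPl (v - w)
  rw [map_sub, show P v = P w from hvw, sub_self, norm_zero, mul_zero] at h
  exact sub_eq_zero.1 (norm_le_zero_iff.1 h)

/-- **The Lorentzian Christoffel trick with a parameter** (bounded-symmetrisation form of layer 3's `norm_snd_le_of_law_lorentz`).
Let `h` be a form on `E4` with `‖h − η‖ ≤ 1/4`, `P` linear with `‖P‖ ≤ L` and `‖v‖ ≤ L ‖P v‖`, `S` symmetric bilinear, and suppose
the symmetrisation in `(v, w)` of `T(u, v, w) = h(S(u, v), P w)` is bounded: `|T(u, v, w) + T(u, w, v)| ≤ K ‖u‖ ‖v‖ ‖w‖`. Then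
`‖S‖ ≤ 2 L K`: `2T(u,v,w) = A(u,v,w) + A(v,u,w) − A(w,u,v)`, then test with `P w = 𝒫 S(u, v)`, `h(p, 𝒫 p) ≥ (3/4)‖p‖²`. Applied
below with `S = D³Θ(t, ·, ·)`. Bartnik 1986, (3.5)–(3.6); Chruściel 1986, §2 (Riemannian: `TransitionRigidity.norm_snd_le_of_law`). [folklore] -/
private theorem norm_snd_le_of_symm_bound_w3 {h₀ : E4 →L[ℝ] E4 →L[ℝ] ℝ} {P : E4 →L[ℝ] E4} {L K : ℝ}
    (hA : ‖h₀ - Minkowski.bilin‖ ≤ 1 / 4) (hPL : ‖P‖ ≤ L) (hPl : ∀ v, ‖v‖ ≤ L * ‖P v‖) (hK : 0 ≤ K)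
    {S : E4 →L[ℝ] E4 →L[ℝ] E4} (hS : ∀ u v, S u v = S v u)
    (hT : ∀ u v w, |h₀ (S u v) (P w) + h₀ (S u w) (P v)| ≤ K * ‖u‖ * ‖v‖ * ‖w‖) :
    ‖S‖ ≤ 2 * L * K := by
  -- adapted from the private `norm_snd_le_of_law_lorentz` (`…KerrAsymptoticRigidityD2`, unbuilt today)
  have hL : 0 ≤ L := (norm_nonneg P).trans hPL
  -- `T` itself is bounded: `2T(u,v,w) = A(u,v,w) + A(v,u,w) − A(w,u,v)`
  have hT' : ∀ u v w, |h₀ (S u v) (P w)| ≤ 3 / 2 * K * ‖u‖ * ‖v‖ * ‖w‖ := by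
    intro u v w
    have e1 := hT u v w; have e2 := hT v u w; have e3 := hT w u v
    rw [hS v u] at e2; rw [hS w u, hS w v] at e3
    rw [abs_le] at e1 e2 e3 ⊢
    constructor <;> linarith [e1.1, e1.2, e2.1, e2.2, e3.1, e3.2]
  -- test with `P w = 𝒫 S(u, v)`
  refine ContinuousLinearMap.opNorm_le_bound₂ _ (by positivity) fun u v ↦ ?_
  obtain ⟨w, hw⟩ := surjective_of_norm_le_w3 hPl (S u v - (2 * S u v 0) • E4.basisVector 0)
  have hwn : ‖w‖ ≤ L * ‖S u v‖ := by simpa only [hw, (timeReflect_w3 _).1] using hPl w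
  have h1 : 3 / 4 * ‖S u v‖ ^ 2 ≤ h₀ (S u v) (S u v - (2 * S u v 0) • E4.basisVector 0) :=
    sq_le_apply_timeReflect_w3 hA _
  have h2 : h₀ (S u v) (S u v - (2 * S u v 0) • E4.basisVector 0) ≤ 3 / 2 * K * ‖u‖ * ‖v‖ * ‖w‖ := by
    simpa only [hw] using (le_abs_self _).trans (hT' u v w)
  have h3 : ‖S u v‖ ^ 2 ≤ (2 * L * K * ‖u‖ * ‖v‖) * ‖S u v‖ := by
    have : 3 / 2 * K * ‖u‖ * ‖v‖ * ‖w‖ ≤ 3 / 2 * K * ‖u‖ * ‖v‖ * (L * ‖S u v‖) := by gcongr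
    nlinarith
  by_cases h0 : ‖S u v‖ = 0
  · rw [h0]; positivity
  · calc ‖S u v‖ = ‖S u v‖ ^ 2 / ‖S u v‖ := by rw [sq, mul_div_cancel_right₀ _ h0]
      _ ≤ (2 * L * K * ‖u‖ * ‖v‖) * ‖S u v‖ / ‖S u v‖ := by gcongr
      _ = 2 * L * K * ‖u‖ * ‖v‖ := mul_div_cancel_right₀ _ h0

/-! ## §2 The second differentiated transformation law; norm bookkeeping -/

section Calculus

variable {F G : Type*} [NormedAddCommGroup F] [NormedSpace ℝ F] [NormedAddCommGroup G] [NormedSpace ℝ G]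

/-- Evaluation at a fixed vector commutes with differentiation: if `c` has derivative `c'` at `y` then
`z ↦ c z a` has derivative `c'.flip a` there. [folklore] -/
private theorem hasFDerivAt_apply_const_w3 {c : E4 → F →L[ℝ] G} {c' : E4 →L[ℝ] F →L[ℝ] G} {y : E4} (hc : HasFDerivAt c c' y)
    (a : F) : HasFDerivAt (fun z ↦ c z a) (c'.flip a) y := by
  simpa only [ContinuousLinearMap.comp_zero, zero_add] using hc.clm_apply (hasFDerivAt_const a y)

/-- **The second differentiated transformation law.** If near `y` the once-differentiated law
`Dh'(z)(u,v,w) = Dh(Gz)(DG u, DG v, DG w) + h(Gz)(D²G(u,v), DG w) + h(Gz)(DG v, D²G(u,w))` holds (`TransitionRigidity.fderiv_law_apply`),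
`G` is `C³` at `y`, `h` is `C²` at `G y` and `h'` is `C²` at `y`, then `D²h'(y)(t,u,v,w)` is the sum of the ten terms produced by the
product and chain rules, exactly two of which contain `D³G`: `h(Gy)(D³G(t,u,v), DG w)` and `h(Gy)(DG v, D³G(t,u,w))`. Bartnik 1986,
§3, proof of Cor. 3.2 (one more differentiation of (3.5)–(3.6)); Chruściel 1986, §2. [folklore] -/
private theorem fderiv_fderiv_law_apply_w3 {h h' : E4 → E4 →L[ℝ] E4 →L[ℝ] ℝ} {G : E4 → E4} {y : E4}
    (hlaw : ∀ᶠ z in 𝓝 y, ∀ u v w, fderiv ℝ h' z u v w = fderiv ℝ h (G z) (fderiv ℝ G z u) (fderiv ℝ G z v) (fderiv ℝ G z w)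
      + h (G z) (fderiv ℝ (fderiv ℝ G) z u v) (fderiv ℝ G z w) + h (G z) (fderiv ℝ G z v) (fderiv ℝ (fderiv ℝ G) z u w))
    (hG : ContDiffAt ℝ 3 G y) (hh : ContDiffAt ℝ 2 h (G y)) (hh' : ContDiffAt ℝ 2 h' y) (t u v w : E4) :
    fderiv ℝ (fderiv ℝ h') y t u v w =
      fderiv ℝ (fderiv ℝ h) (G y) (fderiv ℝ G y t) (fderiv ℝ G y u) (fderiv ℝ G y v) (fderiv ℝ G y w)
      + fderiv ℝ h (G y) (fderiv ℝ (fderiv ℝ G) y t u) (fderiv ℝ G y v) (fderiv ℝ G y w)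
      + fderiv ℝ h (G y) (fderiv ℝ G y u) (fderiv ℝ (fderiv ℝ G) y t v) (fderiv ℝ G y w)
      + fderiv ℝ h (G y) (fderiv ℝ G y u) (fderiv ℝ G y v) (fderiv ℝ (fderiv ℝ G) y t w)
      + fderiv ℝ h (G y) (fderiv ℝ G y t) (fderiv ℝ (fderiv ℝ G) y u v) (fderiv ℝ G y w)
      + h (G y) (fderiv ℝ (fderiv ℝ (fderiv ℝ G)) y t u v) (fderiv ℝ G y w)
      + h (G y) (fderiv ℝ (fderiv ℝ G) y u v) (fderiv ℝ (fderiv ℝ G) y t w)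
      + fderiv ℝ h (G y) (fderiv ℝ G y t) (fderiv ℝ G y v) (fderiv ℝ (fderiv ℝ G) y u w)
      + h (G y) (fderiv ℝ (fderiv ℝ G) y t v) (fderiv ℝ (fderiv ℝ G) y u w)
      + h (G y) (fderiv ℝ G y v) (fderiv ℝ (fderiv ℝ (fderiv ℝ G)) y t u w) := by
  have hGd : DifferentiableAt ℝ G y := hG.differentiableAt (by norm_num)
  have hG2 : ContDiffAt ℝ 2 (fderiv ℝ G) y := hG.fderiv_right (m := 2) le_rfl
  have hQ : HasFDerivAt (fderiv ℝ (fderiv ℝ G)) (fderiv ℝ (fderiv ℝ (fderiv ℝ G)) y) y :=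
    ((hG2.fderiv_right (m := 1) le_rfl).differentiableAt one_ne_zero).hasFDerivAt
  have ha := fun a ↦ hasFDerivAt_apply_const_w3 (hG2.differentiableAt (by norm_num)).hasFDerivAt a
  have hb := fun a b ↦ hasFDerivAt_apply_const_w3 (hasFDerivAt_apply_const_w3 hQ a) b
  have hH : HasFDerivAt (fun z ↦ h (G z)) ((fderiv ℝ h (G y)).comp (fderiv ℝ G y)) y :=
    (hh.differentiableAt (by norm_num)).hasFDerivAt.comp y hGd.hasFDerivAt
  have hDH : HasFDerivAt (fun z ↦ fderiv ℝ h (G z)) ((fderiv ℝ (fderiv ℝ h) (G y)).comp (fderiv ℝ G y)) y :=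
    ((hh.fderiv_right (m := 1) le_rfl).differentiableAt one_ne_zero).hasFDerivAt.comp y hGd.hasFDerivAt
  have hR := ((((hDH.clm_apply (ha u)).clm_apply (ha v)).clm_apply (ha w)).add
    ((hH.clm_apply (hb u v)).clm_apply (ha w))).add ((hH.clm_apply (ha v)).clm_apply (hb u w))
  have hL : HasFDerivAt (fun z ↦ fderiv ℝ h' z u v w) ((((fderiv ℝ (fderiv ℝ h') y).flip u).flip v).flip w) y :=
    hasFDerivAt_apply_const_w3 (hasFDerivAt_apply_const_w3 (hasFDerivAt_apply_const_w3
      ((hh'.fderiv_right (m := 1) le_rfl).differentiableAt one_ne_zero).hasFDerivAt u) v) w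
  have key := congrArg (fun φ : E4 →L[ℝ] ℝ ↦ φ t) (hL.unique (hR.congr_of_eventuallyEq (hlaw.mono fun z hz ↦ hz u v w)))
  simp only [add_apply, ContinuousLinearMap.comp_apply, ContinuousLinearMap.flip_apply] at key
  linear_combination key

/-- **The third derivative is symmetric in its last two slots**: if `D²G(z)` is symmetric for `z` near `y` and `G`
is `C³` at `y`, then `D³G(y)(t, a, b) = D³G(y)(t, b, a)` (differentiate `D²G(z)(a, b) = D²G(z)(b, a)` at `y`). [folklore] -/
private theorem fderiv_fderiv_fderiv_symm_w3 {G : E4 → E4} {y : E4}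
    (hs : ∀ᶠ z in 𝓝 y, ∀ a b, fderiv ℝ (fderiv ℝ G) z a b = fderiv ℝ (fderiv ℝ G) z b a)
    (hG : ContDiffAt ℝ 3 G y) (t a b : E4) :
    fderiv ℝ (fderiv ℝ (fderiv ℝ G)) y t a b = fderiv ℝ (fderiv ℝ (fderiv ℝ G)) y t b a := by
  have hQ : HasFDerivAt (fderiv ℝ (fderiv ℝ G)) (fderiv ℝ (fderiv ℝ (fderiv ℝ G)) y) y :=
    (((hG.fderiv_right (m := 2) le_rfl).fderiv_right (m := 1) le_rfl).differentiableAt one_ne_zero).hasFDerivAt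
  have h1 := hasFDerivAt_apply_const_w3 (hasFDerivAt_apply_const_w3 hQ a) b
  have h2 := hasFDerivAt_apply_const_w3 (hasFDerivAt_apply_const_w3 hQ b) a
  simpa only [ContinuousLinearMap.flip_apply] using
    congrArg (fun φ : E4 →L[ℝ] E4 ↦ φ t) (h1.unique (h2.congr_of_eventuallyEq (hs.mono fun z hz ↦ hz a b)))

/-- `‖D¹f(x)‖ = ‖Df(x)‖`. [folklore] -/
private theorem norm_iteratedFDeriv_one_w3 (f : E4 → F) (x : E4) : ‖iteratedFDeriv ℝ 1 f x‖ = ‖fderiv ℝ f x‖ := by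
  rw [← norm_iteratedFDeriv_fderiv, norm_iteratedFDeriv_zero]

/-- `‖D²f(x)‖ = ‖D(Df)(x)‖` (curried iterated derivative). [folklore] -/
private theorem norm_iteratedFDeriv_two_w3 (f : E4 → F) (x : E4) : ‖iteratedFDeriv ℝ 2 f x‖ = ‖fderiv ℝ (fderiv ℝ f) x‖ := by
  rw [← norm_iteratedFDeriv_fderiv, ← norm_iteratedFDeriv_fderiv, norm_iteratedFDeriv_zero]

/-- `‖D³f(x)‖ = ‖D(D(Df))(x)‖` (curried iterated derivative). [folklore] -/
private theorem norm_iteratedFDeriv_three_w3 (f : E4 → F) (x : E4) :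
    ‖iteratedFDeriv ℝ 3 f x‖ = ‖fderiv ℝ (fderiv ℝ (fderiv ℝ f)) x‖ := by
  rw [← norm_iteratedFDeriv_fderiv, ← norm_iteratedFDeriv_fderiv, ← norm_iteratedFDeriv_fderiv, norm_iteratedFDeriv_zero]

/-- `Dⁿ(f − c)(x) = Dⁿf(x)` for `n ≠ 0` (constants drop out). [folklore] -/
private theorem iteratedFDeriv_sub_const_w3 {f : E4 → F} {x : E4} {n : ℕ} (hf : ContDiffAt ℝ n f x) (hn : n ≠ 0) (c : F) :
    iteratedFDeriv ℝ n (fun z ↦ f z - c) x = iteratedFDeriv ℝ n f x := by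
  rw [show (fun z ↦ f z - c) = f - fun _ ↦ c from rfl, iteratedFDeriv_sub_apply hf contDiffAt_const, iteratedFDeriv_const_of_ne hn,
    Pi.zero_apply, sub_zero]

/-- `|β(a, b)| ≤ N⁵ α β'` if `‖β‖ ≤ N`, `‖a‖ ≤ N α`, `‖b‖ ≤ N β'` (`N ≥ 1`). [folklore] -/
private theorem abs_apply₂_le_w3 {N : ℝ} (hN : 1 ≤ N) (β : E4 →L[ℝ] E4 →L[ℝ] ℝ) {a b : E4} {α β' : ℝ} (hβ : ‖β‖ ≤ N)
    (ha : ‖a‖ ≤ N * α) (hb : ‖b‖ ≤ N * β') : |β a b| ≤ N ^ 5 * (α * β') := by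
  have hN0 : 0 < N := one_pos.trans_le hN
  have hα := (mul_nonneg_iff_of_pos_left hN0).1 ((norm_nonneg a).trans ha)
  have hβ0 := (mul_nonneg_iff_of_pos_left hN0).1 ((norm_nonneg b).trans hb)
  calc |β a b| ≤ ‖β‖ * ‖a‖ * ‖b‖ := by rw [← Real.norm_eq_abs]; exact β.le_opNorm₂ a b
    _ ≤ N * (N * α) * (N * β') := by gcongr
    _ = N ^ 3 * (α * β') := by ring
    _ ≤ N ^ 5 * (α * β') := mul_le_mul_of_nonneg_right (pow_le_pow_right₀ hN (by norm_num)) (by positivity)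

/-- `|τ(a, b, c)| ≤ N⁵ α β' γ` if `‖τ‖ ≤ N`, `‖a‖ ≤ N α`, `‖b‖ ≤ N β'`, `‖c‖ ≤ N γ` (`N ≥ 1`). [folklore] -/
private theorem abs_apply₃_le_w3 {N : ℝ} (hN : 1 ≤ N) (τ : E4 →L[ℝ] E4 →L[ℝ] E4 →L[ℝ] ℝ) {a b c : E4} {α β' γ : ℝ}
    (hτ : ‖τ‖ ≤ N) (ha : ‖a‖ ≤ N * α) (hb : ‖b‖ ≤ N * β') (hc : ‖c‖ ≤ N * γ) : |τ a b c| ≤ N ^ 5 * (α * β' * γ) := by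
  have hN0 : 0 < N := one_pos.trans_le hN
  have hα := (mul_nonneg_iff_of_pos_left hN0).1 ((norm_nonneg a).trans ha)
  have hβ0 := (mul_nonneg_iff_of_pos_left hN0).1 ((norm_nonneg b).trans hb)
  have hγ := (mul_nonneg_iff_of_pos_left hN0).1 ((norm_nonneg c).trans hc)
  calc |τ a b c| ≤ ‖τ a b‖ * ‖c‖ := by rw [← Real.norm_eq_abs]; exact (τ a b).le_opNorm c
    _ ≤ ‖τ‖ * ‖a‖ * ‖b‖ * ‖c‖ := by gcongr; exact τ.le_opNorm₂ a b
    _ ≤ N * (N * α) * (N * β') * (N * γ) := by gcongr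
    _ = N ^ 4 * (α * β' * γ) := by ring
    _ ≤ N ^ 5 * (α * β' * γ) := mul_le_mul_of_nonneg_right (pow_le_pow_right₀ hN (by norm_num)) (by positivity)

/-- `|θ(a, b, c, d)| ≤ N⁵ α β' γ δ` if `‖θ‖ ≤ N` and `‖a‖ ≤ N α`, …, `‖d‖ ≤ N δ` (`N ≥ 1`). [folklore] -/
private theorem abs_apply₄_le_w3 {N : ℝ} (hN : 1 ≤ N) (θ : E4 →L[ℝ] E4 →L[ℝ] E4 →L[ℝ] E4 →L[ℝ] ℝ) {a b c d : E4} {α β' γ δ : ℝ}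
    (hθ : ‖θ‖ ≤ N) (ha : ‖a‖ ≤ N * α) (hb : ‖b‖ ≤ N * β') (hc : ‖c‖ ≤ N * γ) (hd : ‖d‖ ≤ N * δ) :
    |θ a b c d| ≤ N ^ 5 * (α * β' * γ * δ) := by
  have hN0 : 0 < N := one_pos.trans_le hN
  have hα := (mul_nonneg_iff_of_pos_left hN0).1 ((norm_nonneg a).trans ha)
  have hβ0 := (mul_nonneg_iff_of_pos_left hN0).1 ((norm_nonneg b).trans hb)
  have hγ := (mul_nonneg_iff_of_pos_left hN0).1 ((norm_nonneg c).trans hc)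
  calc |θ a b c d| ≤ ‖θ a b c‖ * ‖d‖ := by rw [← Real.norm_eq_abs]; exact (θ a b c).le_opNorm d
    _ ≤ ‖θ a b‖ * ‖c‖ * ‖d‖ := by gcongr; exact (θ a b).le_opNorm c
    _ ≤ ‖θ‖ * ‖a‖ * ‖b‖ * ‖c‖ * ‖d‖ := by gcongr; exact θ.le_opNorm₂ a b
    _ ≤ N * (N * α) * (N * β') * (N * γ) * (N * δ) := by gcongr
    _ = N ^ 5 * (α * β' * γ * δ) := by ring

end Calculus

/-! ## §3 The two metrics far out -/

/-- The components of an adapted chart are symmetric on its domain (`A.bilin = φ^* g` there). [folklore] -/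
private theorem adaptedChart_bilin_symm_w3 {𝓑 : StationaryAFBlackHole.{0}} (A : 𝓑.AdaptedChart) {u : E4} (hu : u ∈ A.domain) (v w : E4) :
    A.bilin u v w = A.bilin u w v := by
  -- private copy of `adaptedChart_bilin_symm` (`…KerrAsymptoticRigidityD2`, unbuilt today)
  rw [A.bilin_eq ⟨u, hu⟩]
  exact pullbackBilin_symm (I := 𝓡 4) (I' := 𝓘(ℝ, E4)) A.toFun 𝓑.metric.val (fun x v w ↦ 𝓑.metric.symm x v w) ⟨u, hu⟩ v w

/-- **The first two derivatives of the chart components are bounded far out**: in an asymptotically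
Schwarzschildean (`C²`) adapted chart, `‖Dⁿ(A.bilin)(y)‖ ≤ B` (`n = 1, 2`) for `y ∈ A.domain` with
`A.radius y ≥ R₂`: `Dⁿ(A.bilin − g_{M_A,0}) = O(r_A^{−n−2})` by the `C²` clause, `Dⁿ(g_{M_A,0} − η) = O(1/‖y_{space}‖)`
by `Kerr.norm_iteratedFDeriv_ksPert_le`, and `|A.radius − ‖·_{space}‖| ≤ C_A`. [folklore] -/
private theorem exists_norm_iteratedFDeriv_adaptedChart_bilin_le_w3 {𝓑 : StationaryAFBlackHole.{0}} (A : 𝓑.AdaptedChart)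
    (hschw : ChartIsAsymptoticallySchwarzschildean' A) : ∃ R₂ B : ℝ, ∀ y ∈ (A.domain : Set E4), R₂ ≤ A.radius y →
      ‖iteratedFDeriv ℝ 1 A.bilin y‖ ≤ B ∧ ‖iteratedFDeriv ℝ 2 A.bilin y‖ ≤ B := by
  obtain ⟨MA, CA, RA, -, hder⟩ := hschw
  obtain ⟨C₁, R₁, hR₁, hK₁⟩ := Kerr.norm_iteratedFDeriv_ksPert_le MA 0 1
  obtain ⟨C₂, R₂, hR₂, hK₂⟩ := Kerr.norm_iteratedFDeriv_ksPert_le MA 0 2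
  obtain ⟨D, hD⟩ := A.exists_abs_radius_sub_spatialNorm_le
  refine ⟨max (max RA 1) (max R₁ R₂ + D), |CA| + (|C₁| / R₁ + |C₂| / R₂), fun y hy hyR ↦ ?_⟩
  simp only [max_le_iff] at hyR
  obtain ⟨⟨hRA, h1⟩, h12⟩ := hyR
  have hsp : max R₁ R₂ ≤ Kerr.radius 0 y := by rw [Kerr.radius_zero_left]; linarith [(abs_le.1 (hD y)).2]
  have hr0 : 0 < Kerr.radius 0 y := hR₁.trans_le ((le_max_left _ _).trans hsp)
  have hA : ContDiffAt ℝ ∞ A.bilin y := (contDiffOn_adaptedChart_bilin A).contDiffAt (A.domain.isOpen.mem_nhds hy)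
  -- the estimate at order `n`, given the Kerr–Schild decay at order `n`
  have key : ∀ n : ℕ, n ≠ 0 → n ≤ 2 → ∀ {C R : ℝ}, 0 < R → R ≤ Kerr.radius 0 y →
      ‖iteratedFDeriv ℝ n (fun z ↦ Kerr.bilin MA 0 z - Minkowski.bilin) y‖ ≤ C / Kerr.radius 0 y →
      ‖iteratedFDeriv ℝ n A.bilin y‖ ≤ |CA| + |C| / R := by
    intro n hn hn2 C R hR hRy hK
    have hAn : ContDiffAt ℝ n A.bilin y := hA.of_le (by exact_mod_cast le_top)
    have hKn : ContDiffAt ℝ n (Kerr.bilin MA 0) y := Kerr.contDiffAt_bilin MA 0 hr0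
    have e1 : iteratedFDeriv ℝ n A.bilin y = iteratedFDeriv ℝ n (fun z ↦ A.bilin z - Kerr.bilin MA 0 z) y +
        iteratedFDeriv ℝ n (fun z ↦ Kerr.bilin MA 0 z - Minkowski.bilin) y := by
      rw [iteratedFDeriv_sub_const_w3 hKn hn, show (fun z ↦ A.bilin z - Kerr.bilin MA 0 z) = A.bilin - Kerr.bilin MA 0 from rfl,
        iteratedFDeriv_sub_apply hAn hKn, sub_add_cancel]
    rw [e1]
    refine (norm_add_le _ _).trans (add_le_add ((hder ⟨y, hy⟩ hRA n hn2).trans ?_) (hK.trans ?_))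
    · calc CA / A.radius y ^ (n + 2) ≤ |CA| / A.radius y ^ (n + 2) := by gcongr; exact le_abs_self _
        _ ≤ |CA| / 1 := div_le_div_of_nonneg_left (abs_nonneg _) one_pos (one_le_pow₀ h1)
        _ = |CA| := div_one _
    · calc C / Kerr.radius 0 y ≤ |C| / Kerr.radius 0 y := by gcongr; exact le_abs_self _
        _ ≤ |C| / R := div_le_div_of_nonneg_left (abs_nonneg _) hR hRy
  have k1 := key 1 one_ne_zero (by norm_num) hR₁ ((le_max_left _ _).trans hsp) (hK₁ y ((le_max_left _ _).trans hsp))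
  have k2 := key 2 two_ne_zero le_rfl hR₂ ((le_max_right _ _).trans hsp) (hK₂ y ((le_max_right _ _).trans hsp))
  have := div_nonneg (abs_nonneg C₁) hR₁.le; have := div_nonneg (abs_nonneg C₂) hR₂.le
  constructor <;> linarith

/-! ## §4 The registered helper -/

/-- **Registered helper `kerrAsymptoticRigidity_iteratedFDeriv_three_bounded`** (layer 10 of F4 = `KerrAsymptoticRigidity`; its binder
list verbatim, then `c = 1` and the conclusions of layers 2 and 4 as hypotheses): the THIRD derivatives of the chart identification
`Θ` are bounded far out. At a far point `u` differentiate the once-differentiated isometry law (`TransitionRigidity.fderiv_law_apply`,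
valid all over the open exterior) once more (`fderiv_fderiv_law_apply_w3`): for each `t` the symmetrisation in `(v, w)` of
`T_t(u', v, w) = A.bilin(Θu)(D³Θ(t, u', v), dΘ w)` is `D²g_{M,a}(u)(t, u', v, w)` minus eight products of `dΘ, D²Θ` (bounded by `L`,
`L₂`) with `A.bilin, D A.bilin, D² A.bilin ∘ Θ` (bounded far out: `1/4`-closeness, `exists_norm_iteratedFDeriv_adaptedChart_bilin_le_w3`),
and `‖D²g_{M,a}‖ ≤ C/r` (`Kerr.norm_iteratedFDeriv_ksPert_le`); `D³Θ(t, ·, ·)` being symmetric (`fderiv_fderiv_fderiv_symm_w3`), the trick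
`norm_snd_le_of_symm_bound_w3` gives `‖D³Θ(u)(t, ·, ·)‖ ≤ 18 L N⁵ ‖t‖`. Bartnik 1986, §3, Cor. 3.2; Chruściel–Costa, §2.1. [folklore] -/
theorem kerrAsymptoticRigidity_iteratedFDeriv_three_bounded : ∀ (𝓑 : StationaryAFBlackHole.{0}) (A : 𝓑.AdaptedChart) (M a c : ℝ) (Θ : E4 → E4), ChartIsAsymptoticallyCartesian A → ChartIsAsymptoticallySchwarzschildean' A → Kerr.IsSubextremal M a → 0 < c → ContDiffOn ℝ ∞ Θ (Kerr.exterior M a : Set E4) → Set.InjOn Θ (Kerr.exterior M a : Set E4) → Set.MapsTo Θ (Kerr.exterior M a : Set E4) (A.domain : Set E4) → (∀ x ∈ (Kerr.exterior M a : Set E4), ∀ s : ℝ, Θ (x + s • E4.basisVector 0) = Θ x + (c * s) • E4.basisVector 0) → (∀ x ∈ (Kerr.exterior M a : Set E4), ∀ v w : E4, A.bilin (Θ x) (fderiv ℝ Θ x v) (fderiv ℝ Θ x w) = Kerr.bilin M a x v w) → Θ '' (Kerr.exterior M a : Set E4) = {u : E4 | ∃ h : u ∈ A.domain, A.toFun ⟨u,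 h⟩ ∈ 𝓑.doc} → (∀ R₁ : ℝ, ∃ R : ℝ, ∀ x ∈ (Kerr.exterior M a : Set E4), R ≤ Kerr.radius a x → R₁ ≤ A.radius (Θ x)) → c = 1 → ∀ R L : ℝ, (∀ u ∈ (Kerr.exterior M a : Set E4), R ≤ Kerr.radius a u → ‖fderiv ℝ Θ u‖ ≤ L ∧ ∀ v : E4, ‖v‖ ≤ L * ‖fderiv ℝ Θ u v‖) → (∃ R' L₂ : ℝ, ∀ u ∈ (Kerr.exterior M a : Set E4), R' ≤ Kerr.radius a u → ‖iteratedFDeriv ℝ 2 Θ u‖ ≤ L₂) → ∃ R₃ L₃ : ℝ, ∀ u ∈ (Kerr.exterior M a : Set E4), R₃ ≤ Kerr.radius a u → ‖iteratedFDeriv ℝ 3 Θ u‖ ≤ L₃ := by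
  intro 𝓑 A M a c Θ hcart hschw _ _ hΘs _ hΘmaps _ hΘiso _ hfar _ R L hRL h4
  obtain ⟨R', L₂, hL₂⟩ := h4
  have hSo : IsOpen (Kerr.exterior M a : Set E4) := (Kerr.exterior M a).isOpen
  obtain ⟨R₀, hR₀⟩ := hcart.1 (1 / 4) (by norm_num)
  obtain ⟨R₁, hR₁⟩ := hfar R₀
  obtain ⟨CK, RK, -, hK⟩ := Kerr.norm_iteratedFDeriv_ksPert_le M a 2
  obtain ⟨R₂, B, hB⟩ := exists_norm_iteratedFDeriv_adaptedChart_bilin_le_w3 A hschw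
  obtain ⟨R₃, hR₃⟩ := hfar R₂
  -- one constant dominating all the data
  obtain ⟨N, hN1, hLN, hL₂N, hBN, hCKN, hηN⟩ : ∃ N : ℝ, 1 ≤ N ∧ L ≤ N ∧ L₂ ≤ N ∧ |B| ≤ N ∧ |CK| ≤ N ∧
      ‖(Minkowski.bilin : E4 →L[ℝ] E4 →L[ℝ] ℝ)‖ + 1 / 4 ≤ N := by
    have := abs_nonneg L; have := abs_nonneg L₂; have := abs_nonneg B; have := abs_nonneg CK; have := le_abs_self L
    have := norm_nonneg (Minkowski.bilin : E4 →L[ℝ] E4 →L[ℝ] ℝ); have := le_abs_self L₂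
    exact ⟨1 + |L| + |L₂| + |B| + |CK| + ‖(Minkowski.bilin : E4 →L[ℝ] E4 →L[ℝ] ℝ)‖, by linarith, by linarith, by linarith, by linarith,
      by linarith, by linarith⟩
  have hN0 : 0 < N := one_pos.trans_le hN1
  refine ⟨max (max (max R R') (max R₁ R₃)) (max RK 1), 2 * L * (9 * N ^ 5), fun u hu huR ↦ ?_⟩
  simp only [max_le_iff] at huR
  obtain ⟨⟨⟨huR, huR'⟩, huR₁, huR₃⟩, huRK, hu1⟩ := huR
  obtain ⟨hPL, hPl⟩ := hRL u hu huR
  have hdom : Θ u ∈ A.domain := hΘmaps hu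
  have hAu : ‖A.bilin (Θ u) - Minkowski.bilin‖ ≤ 1 / 4 := hR₀ ⟨Θ u, hdom⟩ (hR₁ u hu huR₁)
  obtain ⟨hB₁, hB₂⟩ := hB (Θ u) hdom (hR₃ u hu huR₃)
  have hr : 0 < Kerr.radius a u := Kerr.radius_pos_of_mem_region hu
  -- smoothness at `u`
  have hxn : (Kerr.exterior M a : Set E4) ∈ 𝓝 u := hSo.mem_nhds hu
  have hΘ3 : ContDiffAt ℝ 3 Θ u := (hΘs.contDiffAt hxn).of_le (WithTop.coe_le_coe.mpr le_top)
  have hh : ContDiffAt ℝ 2 A.bilin (Θ u) :=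
    ((contDiffOn_adaptedChart_bilin A).contDiffAt (A.domain.isOpen.mem_nhds hdom)).of_le (WithTop.coe_le_coe.mpr le_top)
  have hg : ContDiffAt ℝ 2 (Kerr.bilin M a) u := Kerr.contDiffAt_bilin M a hr
  -- the once-differentiated transformation law holds all over the open exterior, hence near `u`
  have hlaw : ∀ᶠ z in 𝓝 u, ∀ t v w, fderiv ℝ (Kerr.bilin M a) z t v w =
      fderiv ℝ A.bilin (Θ z) (fderiv ℝ Θ z t) (fderiv ℝ Θ z v) (fderiv ℝ Θ z w) + A.bilin (Θ z) (fderiv ℝ (fderiv ℝ Θ) z t v) (fderiv ℝ Θ z w)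
        + A.bilin (Θ z) (fderiv ℝ Θ z v) (fderiv ℝ (fderiv ℝ Θ) z t w) := by
    refine Filter.eventually_of_mem hxn fun z hz t v w ↦ ?_
    have hzn : (Kerr.exterior M a : Set E4) ∈ 𝓝 z := hSo.mem_nhds hz
    exact TransitionRigidity.fderiv_law_apply (Filter.eventually_of_mem hzn fun x hx v w ↦ (hΘiso x hx v w).symm)
      ((hΘs.contDiffAt hzn).of_le (WithTop.coe_le_coe.mpr le_top)) (((contDiffOn_adaptedChart_bilin A).contDiffAt
        (A.domain.isOpen.mem_nhds (hΘmaps hz))).differentiableAt (by simp)) (Kerr.differentiableAt_bilin M a ⟨z, hz⟩) t v w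
  have hdlaw := fderiv_fderiv_law_apply_w3 hlaw hΘ3 hh hg
  -- symmetries
  have hs2 : ∀ᶠ z in 𝓝 u, ∀ v w, fderiv ℝ (fderiv ℝ Θ) z v w = fderiv ℝ (fderiv ℝ Θ) z w v :=
    Filter.eventually_of_mem hxn fun z hz v w ↦ (hΘs.contDiffAt (hSo.mem_nhds hz)).isSymmSndFDerivAt
      (by simp only [minSmoothness_of_isRCLikeNormedField]; exact WithTop.coe_le_coe.mpr le_top) v w
  have hsym : ∀ p q, A.bilin (Θ u) p q = A.bilin (Θ u) q p := fun p q ↦ adaptedChart_bilin_symm_w3 A hdom p q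
  -- the data and their bounds by `N`
  have hI : ∀ x : E4, ‖x‖ ≤ N * ‖x‖ := fun x ↦ le_mul_of_one_le_left (norm_nonneg _) hN1
  have hP : ∀ x, ‖fderiv ℝ Θ u x‖ ≤ N * ‖x‖ := fun x ↦ ((fderiv ℝ Θ u).le_opNorm x).trans (by gcongr; exact hPL.trans hLN)
  have hQ2 : ‖fderiv ℝ (fderiv ℝ Θ) u‖ ≤ N := by rw [← norm_iteratedFDeriv_two_w3]; exact (hL₂ u hu huR').trans hL₂N
  have hQ : ∀ x y, ‖fderiv ℝ (fderiv ℝ Θ) u x y‖ ≤ N * (‖x‖ * ‖y‖) := fun x y ↦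
    ((fderiv ℝ (fderiv ℝ Θ) u).le_opNorm₂ x y).trans (by rw [mul_assoc]; gcongr)
  have h0N : ‖A.bilin (Θ u)‖ ≤ N := (norm_le_insert' (A.bilin (Θ u)) Minkowski.bilin).trans (by linarith)
  have h1N : ‖fderiv ℝ A.bilin (Θ u)‖ ≤ N := by rw [← norm_iteratedFDeriv_one_w3]; exact hB₁.trans ((le_abs_self B).trans hBN)
  have h2N : ‖fderiv ℝ (fderiv ℝ A.bilin) (Θ u)‖ ≤ N := by rw [← norm_iteratedFDeriv_two_w3]; exact hB₂.trans ((le_abs_self B).trans hBN)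
  have hgN : ‖fderiv ℝ (fderiv ℝ (Kerr.bilin M a)) u‖ ≤ N := by
    rw [← norm_iteratedFDeriv_two_w3, ← iteratedFDeriv_sub_const_w3 hg two_ne_zero Minkowski.bilin]
    refine (hK u huRK).trans ((div_le_div_of_nonneg_right (le_abs_self CK) hr.le).trans ((div_le_self (abs_nonneg _) hu1).trans hCKN))
  -- the Christoffel trick, one parameter `t` at a time
  have hC : ∀ t, ‖fderiv ℝ (fderiv ℝ (fderiv ℝ Θ)) u t‖ ≤ 2 * L * (9 * N ^ 5 * ‖t‖) := by
    intro t
    refine norm_snd_le_of_symm_bound_w3 hAu hPL hPl (by positivity) (fun v w ↦ fderiv_fderiv_fderiv_symm_w3 hs2 hΘ3 t v w) fun x v w ↦ ?_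
    have e := hdlaw t x v w
    rw [hsym (fderiv ℝ Θ u v) (fderiv ℝ (fderiv ℝ (fderiv ℝ Θ)) u t x w)] at e
    -- the nine known terms
    have b0 := abs_apply₄_le_w3 hN1 (fderiv ℝ (fderiv ℝ (Kerr.bilin M a)) u) hgN (hI t) (hI x) (hI v) (hI w)
    have b1 := abs_apply₄_le_w3 hN1 (fderiv ℝ (fderiv ℝ A.bilin) (Θ u)) h2N (hP t) (hP x) (hP v) (hP w)
    have b2 := abs_apply₃_le_w3 hN1 (fderiv ℝ A.bilin (Θ u)) h1N (hQ t x) (hP v) (hP w)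
    have b3 := abs_apply₃_le_w3 hN1 (fderiv ℝ A.bilin (Θ u)) h1N (hP x) (hQ t v) (hP w)
    have b4 := abs_apply₃_le_w3 hN1 (fderiv ℝ A.bilin (Θ u)) h1N (hP x) (hP v) (hQ t w)
    have b5 := abs_apply₃_le_w3 hN1 (fderiv ℝ A.bilin (Θ u)) h1N (hP t) (hQ x v) (hP w)
    have b6 := abs_apply₂_le_w3 hN1 (A.bilin (Θ u)) h0N (hQ x v) (hQ t w)
    have b7 := abs_apply₃_le_w3 hN1 (fderiv ℝ A.bilin (Θ u)) h1N (hP t) (hP v) (hQ x w)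
    have b8 := abs_apply₂_le_w3 hN1 (A.bilin (Θ u)) h0N (hQ t v) (hQ x w)
    rw [abs_le] at b0 b1 b2 b3 b4 b5 b6 b7 b8 ⊢
    constructor <;> linarith [b0.1, b0.2, b1.1, b1.2, b2.1, b2.2, b3.1, b3.2, b4.1, b4.2, b5.1, b5.2, b6.1, b6.2, b7.1, b7.2, b8.1, b8.2]
  -- conclusion
  rw [norm_iteratedFDeriv_three_w3]
  have hL0 : 0 ≤ L := (norm_nonneg _).trans hPL
  exact ContinuousLinearMap.opNorm_le_bound _ (by positivity) fun t ↦ (hC t).trans_eq (by ring)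

end Summit.FinalStateConjecture.FinalStateConjecture.Theorems.SymplecticDualOfTheBomb

end
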